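import Literature.Computability.AlgebraicComplexity.RankMethodBarriers
import Literature.Computability.AlgebraicComplexity.FlatteningBound
import HarnessLib

/-!
# TetrahedronTensorCore — the tetrahedron graph tensor `T(K₄)_n`, its exponent `ω(K₄)`, and the
bracket `4 ≤ ω(K₄) ≤ 6`

(decomp-mm lens 6 «barrier-complement carving», gen 13; kernel of the node `TetrahedronCarving`:
`ω = 2 ⟺ [ω(K₄) ≤ 4] ∧ [2ω ≤ ω(K₄)]`, whose cover half `ω(K₄) ≤ 2ω` and exactness are in the
companion module `TetrahedronTensor`.)

Source: M. Christandl, P. Vrana, J. Zuiddam, *Asymptotic tensor rank of graph tensors: beyond matrix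
multiplication*, comput. complexity 28 (2019) 57–111, arXiv:1609.07476 [CVZ19]: Ex. 1.1.2 (graph
tensor of a graph: one EPR pair of size `n` per edge, regrouped at the vertices), Def. 1.1.25
(exponent per edge `τ(T(G)) = ω(T(G))/|E|`), §1.2 eq. (flat) (flattening along a max-cut:
`ω(T(K_k)) ≥ f(K_k)`, `f(K₄) = 4`) and the table of §1.2 (`4 ≤ ω(T(K₄)) ≤ 4.63766 ≤ 6`).
The rank notion is the tree's `tensorRankD` (`d = 4`, cubic format of side `n³`;
Efremenko–Garg–Oliveira–Wigderson 2018, `RankMethodBarriers.lean`).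

What is proved here (every field `F`, sorry-free): `tetra F n : (Fin 4 → Fin (n^3)) → F` is the
tetrahedron tensor (leg index `Fin (n^3) ≃ (Fin 3 → Fin n)` by `finFunctionFinEquiv`; edges ordered
`01,02,03,12,13,23`); `tetra_eq_sum` (the explicit `n⁶`-term rank-one decomposition, CVZ19 Ex. 1.1.2)
and `tensorRankD_tetra_le : R₄(T(K₄)_n) ≤ n⁶`; the `{0,1}|{2,3}` flattening
`pow_four_le_tensorRankD_tetra' : n⁴ ≤ R₄(T(K₄)_n)` (`n⁴` linearly independent slices); the admissible
exponents `tetraAdmissibleExponents F = {β | R₄(T(K₄)_n) = O(n^β)}`, the exponent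
`omegaTetra F = sInf …` (`ω(K₄)`), and `four_le_omegaTetra`, `omegaTetra_le_six`.
No `sorry`, no new axiom, no instance, no notation, no `Prop`-valued definition.
-/

noncomputable section

-- D-0017 nested layout `Summits/<Summit>/<Sub>/…` with `Sub = Summit` duplicates a namespace component.
set_option linter.dupNamespace false

open scoped BigOperators
open Filter Asymptotics Module
open Literature.Computability.AlgebraicComplexity

namespace Summit.MatrixMultiplication.MatrixMultiplication.Theorems.TetrahedronTensor

/-! ## The tetrahedron tensor `T(K₄)_n` -/

section Tensor

variable (F : Type*) [Field F]

/-- The label triples seen at the four vertices of `K₄` under an edge labelling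
`e : Fin 6 → Fin n` of the edges `01, 02, 03, 12, 13, 23` (in this order): vertex `0` sees
`(e₀₁, e₀₂, e₀₃)`, vertex `1` sees `(e₀₁, e₁₂, e₁₃)`, vertex `2` sees `(e₀₂, e₁₂, e₂₃)`, vertex `3`
sees `(e₀₃, e₁₃, e₂₃)`. (CVZ19, Ex. 1.1.2). -/
def vertexLabels {n : ℕ} (e : Fin 6 → Fin n) : Fin 4 → Fin 3 → Fin n :=
  ![![e 0, e 1, e 2], ![e 0, e 3, e 4], ![e 1, e 3, e 5], ![e 2, e 4, e 5]]

/-- A 4-tuple of label triples `L v : Fin 3 → Fin n` is CONSISTENT when the two endpoints of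
every edge of `K₄` carry the same label on that edge (slot conventions of `vertexLabels`); a
Boolean test (no `Prop`-valued definition is introduced). (CVZ19, Def. 1.1.1). -/
def consistent {n : ℕ} (L : Fin 4 → Fin 3 → Fin n) : Bool :=
  decide (L 0 0 = L 1 0 ∧ L 0 1 = L 2 0 ∧ L 0 2 = L 3 0 ∧ L 1 1 = L 2 1 ∧ L 1 2 = L 3 1 ∧ L 2 2 = L 3 2)

/-- Unfolding the consistency test. -/
theorem consistent_iff {n : ℕ} (L : Fin 4 → Fin 3 → Fin n) :
    consistent L = true ↔
      (L 0 0 = L 1 0 ∧ L 0 1 = L 2 0 ∧ L 0 2 = L 3 0 ∧ L 1 1 = L 2 1 ∧ L 1 2 = L 3 1 ∧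
        L 2 2 = L 3 2) :=
  decide_eq_true_iff

/-- **The tetrahedron tensor** `T(K₄)_n ∈ (F^{n³})^{⊗4}` in the cubic format of `tensorRankD`
(`d = 4`, side `n³`, leg index `Fin (n^3) ≃ (Fin 3 → Fin n)` via `finFunctionFinEquiv`): entry `1`
at a consistent 4-tuple of label triples, `0` otherwise; equivalently (`tetra_eq_sum`)
`T(K₄)_n = ∑_{e ∈ [n]^6} b_{e₀₁e₀₂e₀₃} ⊗ b_{e₀₁e₁₂e₁₃} ⊗ b_{e₀₂e₁₂e₂₃} ⊗ b_{e₀₃e₁₃e₂₃}`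
(CVZ19 Ex. 1.1.2, up to the order of edges, which does not affect rank). -/
def tetra (n : ℕ) : (Fin 4 → Fin (n ^ 3)) → F :=
  fun i => if consistent (fun v => (finFunctionFinEquiv.symm (i v) : Fin 3 → Fin n)) then 1 else 0

/-- The four rank-one legs of the summand of `T(K₄)_n` belonging to the edge labelling `e`. (CVZ19, Ex. 1.1.2). -/
def legVec {n : ℕ} (e : Fin 6 → Fin n) : Fin 4 → Fin (n ^ 3) → F :=
  fun v => Pi.single (finFunctionFinEquiv (vertexLabels e v)) 1

/-- Recover the edge labelling from a (consistent) 4-tuple of label triples. -/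
def decode {n : ℕ} (L : Fin 4 → Fin 3 → Fin n) : Fin 6 → Fin n :=
  ![L 0 0, L 0 1, L 0 2, L 1 1, L 1 2, L 2 2]

variable {F}

/-- The vertex labels of an edge labelling are consistent. -/
theorem consistent_vertexLabels {n : ℕ} (e : Fin 6 → Fin n) :
    consistent (vertexLabels e) = true := by
  simp [consistent, vertexLabels]

/-- `decode` is a left inverse of `vertexLabels`. -/
theorem decode_vertexLabels {n : ℕ} (e : Fin 6 → Fin n) : decode (vertexLabels e) = e := by
  funext k
  fin_cases k <;> simp [decode, vertexLabels]

/-- On consistent 4-tuples of label triples, `vertexLabels ∘ decode` is the identity. -/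
theorem vertexLabels_decode {n : ℕ} {L : Fin 4 → Fin 3 → Fin n} (hL : consistent L = true) :
    vertexLabels (decode L) = L := by
  obtain ⟨h₁, h₂, h₃, h₄, h₅, h₆⟩ := (consistent_iff L).1 hL
  funext v j
  fin_cases v <;> fin_cases j <;> simp [decode, vertexLabels, h₁, h₂, h₃, h₄, h₅, h₆]

/-- Entries of one summand: `(⊗_v b_{vertexLabels e v})(i) = [vertexLabels e = labels of i]`. (CVZ19, Ex. 1.1.2). -/
theorem rankOneTensor_legVec_apply {n : ℕ} (e : Fin 6 → Fin n) (i : Fin 4 → Fin (n ^ 3)) :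
    rankOneTensor (legVec F e) i =
      if vertexLabels e = (fun v => (finFunctionFinEquiv.symm (i v) : Fin 3 → Fin n)) then 1 else 0 := by
  classical
  simp only [rankOneTensor_apply, legVec, Pi.single_apply]
  by_cases h : vertexLabels e = (fun v => (finFunctionFinEquiv.symm (i v) : Fin 3 → Fin n))
  · rw [if_pos h]
    refine Finset.prod_eq_one (fun v _ => ?_)
    have hv : vertexLabels e v = finFunctionFinEquiv.symm (i v) := congrFun h v
    rw [if_pos]
    rw [hv, Equiv.apply_symm_apply]
  · rw [if_neg h]
    obtain ⟨v, hv⟩ : ∃ v, vertexLabels e v ≠ finFunctionFinEquiv.symm (i v) := by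
      by_contra hne
      push Not at hne
      exact h (funext hne)
    refine Finset.prod_eq_zero (Finset.mem_univ v) ?_
    rw [if_neg]
    intro hiv
    apply hv
    rw [hiv, Equiv.symm_apply_apply]

/-- `T(K₄)_n` is the sum over the `n⁶` edge labellings of the rank-one tensors `⊗_v b_{labels at v}`
(CVZ19 Ex. 1.1.2). (CVZ19, Ex. 1.1.2). -/
theorem tetra_eq_sum (n : ℕ) : tetra F n = ∑ e : Fin 6 → Fin n, rankOneTensor (legVec F e) := by
  classical
  funext i
  rw [Finset.sum_apply]
  simp only [rankOneTensor_legVec_apply]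
  set L : Fin 4 → Fin 3 → Fin n := fun v => finFunctionFinEquiv.symm (i v) with hLdef
  show (if consistent L then (1 : F) else 0) =
    ∑ e : Fin 6 → Fin n, if vertexLabels e = L then (1 : F) else 0
  by_cases hL : consistent L = true
  · rw [if_pos hL, Finset.sum_eq_single (decode L)]
    · rw [if_pos (vertexLabels_decode hL)]
    · intro e _ hne
      rw [if_neg]
      intro he
      exact hne (by rw [← he, decode_vertexLabels])
    · intro h
      exact absurd (Finset.mem_univ _) h
  · rw [if_neg hL]
    symm
    refine Finset.sum_eq_zero (fun e _ => ?_)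
    rw [if_neg]
    intro he
    exact hL (he ▸ consistent_vertexLabels e)

/-- The explicit decomposition reindexed by `Fin (n^6)`. (CVZ19, Ex. 1.1.2). -/
theorem sum_fin_rankOneTensor_legVec (n : ℕ) :
    ∑ k : Fin (n ^ 6), rankOneTensor (legVec F (finFunctionFinEquiv.symm k)) = tetra F n := by
  rw [tetra_eq_sum]
  exact Fintype.sum_equiv finFunctionFinEquiv.symm _ _ (fun _ => rfl)

/-- `T(K₄)_n` decomposes over rank-one tensors (so `tensorRankD` is a genuine minimum). -/
theorem tetra_decomposable (n : ℕ) :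
    ∃ s : ℕ, ∃ g : Fin s → ((Fin 4 → Fin (n ^ 3)) → F),
      (∀ k, g k ∈ rankOneTensors F (n ^ 3) 4) ∧ ∑ k, g k = tetra F n :=
  ⟨n ^ 6, fun k => rankOneTensor (legVec F (finFunctionFinEquiv.symm k)),
    fun _ => rankOneTensor_mem _, sum_fin_rankOneTensor_legVec n⟩

/-- **Trivial upper bound** `R₄(T(K₄)_n) ≤ n⁶` (one rank-one tensor per edge labelling; CVZ19
§1.2 table, column "trivial upper bound = number of edges"). (CVZ19, §1.2). -/
theorem tensorRankD_tetra_le (n : ℕ) : tensorRankD (tetra F n) ≤ n ^ 6 :=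
  tensorRankD_le_of_eq_sum _ (sum_fin_rankOneTensor_legVec n)

end Tensor

/-! ## The `{0,1} | {2,3}` flattening: `n⁴ ≤ R₄(T(K₄)_n)` -/

section Flattening

variable {F : Type*} [Field F]

/-- The slice of a 4-tensor at fixed indices on legs `0, 1`. -/
def slice {m : ℕ} (T : (Fin 4 → Fin m) → F) (a b : Fin m) : Fin m → Fin m → F :=
  fun c d => T ![a, b, c, d]

/-- **Slice (flattening) lower bound for 4-tensors.** If a family of `{0,1}`-slices of `T` is
linearly independent, its size is at most `R₄(T)`: a decomposition `T = ∑_{l<r} u_l⁰ ⊗ u_l¹ ⊗ u_l² ⊗ u_l³`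
puts every slice in the span of the `r` matrices `u_l² ⊗ u_l³` (the tree's
`card_le_tensorRank_of_linearIndependent`, one leg more). (CVZ19, §1.2 (flattening)). -/
theorem card_le_tensorRankD_of_linearIndependent {m : ℕ} (T : (Fin 4 → Fin m) → F)
    (hT : ∃ s : ℕ, ∃ g : Fin s → ((Fin 4 → Fin m) → F),
      (∀ k, g k ∈ rankOneTensors F m 4) ∧ ∑ k, g k = T)
    {σ : Type*} [Fintype σ] (a b : σ → Fin m)
    (h : LinearIndependent F (fun s => slice T (a s) (b s))) :
    Fintype.card σ ≤ tensorRankD T := by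
  classical
  obtain ⟨g, hg, hsum⟩ := sComplexity_spec hT
  simp only [rankOneTensors, Set.mem_range] at hg
  choose u hu using hg
  -- the `r` rank-one matrices `u_l² ⊗ u_l³`
  let M : Fin (tensorRankD T) → Fin m → Fin m → F := fun l c d => u l 2 c * u l 3 d
  let W : Submodule F (Fin m → Fin m → F) := Submodule.span F (Set.range M)
  have hmem : ∀ s, slice T (a s) (b s) ∈ W := by
    intro s
    have hslice : slice T (a s) (b s) = ∑ l, (u l 0 (a s) * u l 1 (b s)) • M l := by
      funext c d
      simp only [slice]
      rw [show T ![a s, b s, c, d] = ∑ l, g l ![a s, b s, c, d] from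
          (congrFun hsum.symm _).trans (Finset.sum_apply _ _ _), Finset.sum_apply, Finset.sum_apply]
      refine Finset.sum_congr rfl fun l _ => ?_
      rw [← hu l, rankOneTensor_apply, Fin.prod_univ_four]
      simp [M, mul_assoc]
    rw [hslice]
    exact W.sum_mem fun l _ => W.smul_mem _ (Submodule.subset_span ⟨l, rfl⟩)
  have h' : LinearIndependent F (fun s => (⟨slice T (a s) (b s), hmem s⟩ : W)) :=
    LinearIndependent.of_comp W.subtype h
  calc Fintype.card σ ≤ finrank F W := h'.fintype_card_le_finrank
    _ ≤ Fintype.card (Fin (tensorRankD T)) := finrank_range_le_card M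
    _ = tensorRankD T := Fintype.card_fin _

/-- Leg index of a label triple. -/
def enc {n : ℕ} (x y z : Fin n) : Fin (n ^ 3) := finFunctionFinEquiv ![x, y, z]

/-- Decoding the leg index of a label triple returns the triple. -/
@[simp] theorem symm_enc {n : ℕ} (x y z : Fin n) :
    finFunctionFinEquiv.symm (enc x y z) = ![x, y, z] := by
  simp [enc]

/-- Values of `T(K₄)_n` on encoded label triples. (CVZ19, Ex. 1.1.2). -/
theorem tetra_apply_enc {n : ℕ} (L : Fin 4 → Fin 3 → Fin n) :
    tetra F n (fun v => enc (L v 0) (L v 1) (L v 2)) = if consistent L then 1 else 0 := by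
  have hL : (fun v => (finFunctionFinEquiv.symm (enc (L v 0) (L v 1) (L v 2)) : Fin 3 → Fin n)) = L := by
    funext v j
    rw [symm_enc]
    fin_cases j <;> simp
  simp only [tetra, hL]

/-- The `n⁴` slices of `T(K₄)_n` at legs `0,1` fixed to `(0,b,c), (0,d,e)` (edge `01` labelled `0`)
are linearly independent: the slice of `(b,c,d,e)` is the only one that is non-zero at the point
`((b,d,0),(c,e,0))` of legs `2,3`. (CVZ19, §1.2 (flattening lower bound)). -/
theorem linearIndependent_tetra_slices (n : ℕ) [NeZero n] :
    LinearIndependent F (fun s : Fin n × Fin n × Fin n × Fin n =>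
      slice (tetra F n) (enc 0 s.1 s.2.1) (enc 0 s.2.2.1 s.2.2.2)) := by
  classical
  rw [Fintype.linearIndependent_iff]
  intro g hg s₀
  obtain ⟨b₀, c₀, d₀, e₀⟩ := s₀
  have h := congr_fun (congr_fun hg (enc b₀ d₀ 0)) (enc c₀ e₀ 0)
  rw [Finset.sum_apply, Finset.sum_apply, Fintype.sum_eq_single (b₀, c₀, d₀, e₀)] at h
  · -- the surviving term is `g s₀ * 1`
    have hval : slice (tetra F n) (enc 0 b₀ c₀) (enc 0 d₀ e₀) (enc b₀ d₀ 0) (enc c₀ e₀ 0) = 1 := by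
      have := tetra_apply_enc (F := F) ![![0, b₀, c₀], ![0, d₀, e₀], ![b₀, d₀, 0], ![c₀, e₀, 0]]
      simp only [slice]
      convert this using 2
      · funext v; fin_cases v <;> simp
      · simp [consistent]
    simpa [hval] using h
  · rintro ⟨b, c, d, e⟩ hne
    have hval : slice (tetra F n) (enc 0 b c) (enc 0 d e) (enc b₀ d₀ 0) (enc c₀ e₀ 0) = 0 := by
      have := tetra_apply_enc (F := F) ![![0, b, c], ![0, d, e], ![b₀, d₀, 0], ![c₀, e₀, 0]]
      simp only [slice]
      have hnc : ¬ consistent ![![0, b, c], ![0, d, e], ![b₀, d₀, 0], ![c₀, e₀, 0]] = true := by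
        rw [consistent_iff]
        intro hc
        apply hne
        simp only [Prod.mk.injEq]
        simp at hc
        exact ⟨hc.1, hc.2.1, hc.2.2.1, hc.2.2.2⟩
      rw [if_neg hnc] at this
      convert this using 2
      funext v; fin_cases v <;> simp
    simp [hval]

/-- **Flattening lower bound** `n⁴ ≤ R₄(T(K₄)_n)` for `n ≥ 1` (CVZ19 §1.2: "flattening `T(K_k)`
along a max-cut yields a matrix of rank `2^{f(K_k)}`", `f(K₄) = 4`). (CVZ19, §1.2 (eq. (flat))). -/
theorem pow_four_le_tensorRankD_tetra (n : ℕ) [NeZero n] : n ^ 4 ≤ tensorRankD (tetra F n) := by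
  have h := card_le_tensorRankD_of_linearIndependent (tetra F n) (tetra_decomposable n) _ _
    (linearIndependent_tetra_slices (F := F) n)
  simpa [Fintype.card_prod, Fintype.card_fin, pow_succ, mul_assoc] using h

/-- The flattening bound for all `n` (trivial at `n = 0`). (CVZ19, §1.2 (eq. (flat))). -/
theorem pow_four_le_tensorRankD_tetra' (n : ℕ) : n ^ 4 ≤ tensorRankD (tetra F n) := by
  rcases Nat.eq_zero_or_pos n with rfl | hn
  · simp
  · haveI : NeZero n := ⟨hn.ne'⟩
    exact pow_four_le_tensorRankD_tetra n

end Flattening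

/-! ## The exponent `ω(K₄)` and the bracket `4 ≤ ω(K₄) ≤ 6` -/

section Exponent

variable (F : Type*) [Field F]

/-- Admissible exponents of the tetrahedron: `{β | R₄(T(K₄)_n) = O(n^β)}` (the tree's
`admissibleExponents`, with `⟨n,n,n⟩ = T(K₃)_n` replaced by `T(K₄)_n`; CVZ19 Def. 1.1.13 via
Prop. 1.1.16: `ω(Φ) = lim log R(Φ_n)/log n` for families closed under `⊠`, and
`T(K₄)_a ⊠ T(K₄)_b ≅ T(K₄)_{ab}`). (CVZ19, Def. 1.1.13). -/
def tetraAdmissibleExponents : Set ℝ :=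
  {β : ℝ | (fun n : ℕ => (tensorRankD (tetra F n) : ℝ)) =O[atTop] fun n : ℕ => (n : ℝ) ^ β}

/-- **The exponent of the tetrahedron** `ω(K₄) = inf {β | R₄(T(K₄)_n) = O(n^β)}`; the exponent
per edge is `τ(K₄) = ω(K₄)/6` (CVZ19 Def. 1.1.25). Known: `4 ≤ ω(K₄) ≤ 6 · 0.772318 < 4.634`
(flattening; BCKLOSW26 Thm. 48), and `ω(K₄) ≤ 2ω` (CVZ19 Prop. 1.1.26). (CVZ19, Def. 1.1.25 and Problem 1.2.1). -/
def omegaTetra : ℝ :=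
  sInf (tetraAdmissibleExponents F)

/-- `6` is admissible (`R₄(T(K₄)_n) ≤ n⁶`). [cite: ChristandlVranaZuiddam2016, §1.2 (table)] -/
theorem six_mem_tetraAdmissibleExponents : (6 : ℝ) ∈ tetraAdmissibleExponents F := by
  refine IsBigO.of_bound 1 (Eventually.of_forall fun n => ?_)
  rw [one_mul, Real.norm_of_nonneg (Nat.cast_nonneg _),
    Real.norm_of_nonneg (Real.rpow_nonneg (Nat.cast_nonneg _) _)]
  have h := tensorRankD_tetra_le (F := F) n
  calc (tensorRankD (tetra F n) : ℝ) ≤ (n ^ 6 : ℕ) := by exact_mod_cast h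
    _ = (n : ℝ) ^ (6 : ℝ) := by
      rw [show (6 : ℝ) = (6 : ℕ) by norm_num, Real.rpow_natCast]
      push_cast
      ring

/-- Every admissible exponent of the tetrahedron is `≥ 4` (flattening). [cite: ChristandlVranaZuiddam2016, §1.2 (eq. (flateq))] -/
theorem four_le_of_mem_tetraAdmissibleExponents {β : ℝ} (hβ : β ∈ tetraAdmissibleExponents F) :
    4 ≤ β := by
  by_contra hlt
  rw [not_le] at hlt
  obtain ⟨C, hC⟩ := isBigO_iff.1 hβ
  have hev : ∀ᶠ n : ℕ in atTop, (n : ℝ) ^ (4 - β) ≤ C := by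
    filter_upwards [hC, eventually_gt_atTop 0] with n hn hn0
    have hn0' : (0 : ℝ) < n := Nat.cast_pos.2 hn0
    rw [Real.norm_of_nonneg (Nat.cast_nonneg _),
      Real.norm_of_nonneg (Real.rpow_nonneg (Nat.cast_nonneg _) _)] at hn
    have h4 : (n : ℝ) ^ (4 : ℝ) ≤ C * (n : ℝ) ^ β := by
      refine le_trans ?_ hn
      rw [show (4 : ℝ) = (4 : ℕ) by norm_num, Real.rpow_natCast]
      exact_mod_cast pow_four_le_tensorRankD_tetra' (F := F) n
    rw [Real.rpow_sub hn0', div_le_iff₀ (Real.rpow_pos_of_pos hn0' _)]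
    exact h4
  have hlim : Tendsto (fun n : ℕ => (n : ℝ) ^ (4 - β)) atTop atTop :=
    (tendsto_rpow_atTop (by linarith)).comp tendsto_natCast_atTop_atTop
  obtain ⟨n, hn₁, hn₂⟩ := (hev.and (hlim.eventually_gt_atTop C)).exists
  exact absurd hn₁ (not_le.2 hn₂)

/-- The admissible exponents of `T(K₄)` are nonempty (`6` is one). [cite: ChristandlVranaZuiddam2016, §1.2 (table)] -/
theorem tetraAdmissibleExponents_nonempty : (tetraAdmissibleExponents F).Nonempty :=
  ⟨6, six_mem_tetraAdmissibleExponents F⟩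

/-- The admissible exponents of `T(K₄)` are bounded below by `4`. [cite: ChristandlVranaZuiddam2016, §1.2 (flat)] -/
theorem tetraAdmissibleExponents_bddBelow : BddBelow (tetraAdmissibleExponents F) :=
  ⟨4, fun _ hβ => four_le_of_mem_tetraAdmissibleExponents F hβ⟩

/-- Admissible exponents are upward closed. [folklore] -/
theorem mem_tetraAdmissibleExponents_of_le {β γ : ℝ} (hβ : β ∈ tetraAdmissibleExponents F)
    (h : β ≤ γ) : γ ∈ tetraAdmissibleExponents F := by
  refine hβ.trans ?_
  refine IsBigO.of_bound 1 ?_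
  filter_upwards [eventually_ge_atTop 1] with n hn
  have hn' : (1 : ℝ) ≤ n := by exact_mod_cast hn
  rw [one_mul, Real.norm_of_nonneg (Real.rpow_nonneg (by positivity) _),
    Real.norm_of_nonneg (Real.rpow_nonneg (by positivity) _)]
  exact Real.rpow_le_rpow_of_exponent_le hn' h

/-- **`ω(K₄) ≥ 4`** (flattening; CVZ19 §1.2 table, BCKLOSW26 Remark 21). [cite: ChristandlVranaZuiddam2016, §1.2] -/
theorem four_le_omegaTetra : 4 ≤ omegaTetra F :=
  le_csInf (tetraAdmissibleExponents_nonempty F)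
    fun _ hβ => four_le_of_mem_tetraAdmissibleExponents F hβ

/-- **`ω(K₄) ≤ 6`** (trivial cover by six edges). [cite: ChristandlVranaZuiddam2016, §1.2] -/
theorem omegaTetra_le_six : omegaTetra F ≤ 6 :=
  csInf_le (tetraAdmissibleExponents_bddBelow F) (six_mem_tetraAdmissibleExponents F)

/-- Any exponent strictly above `ω(K₄)` is admissible. [folklore] -/
theorem mem_tetraAdmissibleExponents_of_lt {β : ℝ} (h : omegaTetra F < β) :
    β ∈ tetraAdmissibleExponents F := by
  obtain ⟨γ, hγ, hγβ⟩ := (csInf_lt_iff (tetraAdmissibleExponents_bddBelow F)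
    (tetraAdmissibleExponents_nonempty F)).1 h
  exact mem_tetraAdmissibleExponents_of_le F hγ hγβ.le

end Exponent

end Summit.MatrixMultiplication.MatrixMultiplication.Theorems.TetrahedronTensor

end
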